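import Literature.Barriers.CriticalPhenomena.TimarEncounterPoints
import Literature.Barriers.CriticalPhenomena.TimarOnePartition
import Literature.Barriers.CriticalPhenomena.TimarMassTransport
import HarnessLib

/-!
# Timár 2006, Lemma 5.3 (second part): every heavy branch at an encounter point contains an
# encounter point of the class of the 1-partition — PROVED

Barrier catalogue `Literature/Barriers/CriticalPhenomena/`; a brick of the programme proving
Timár's Thm. 5.5 (`Timar2006_finiteLevelUnion`, `TimarCriticalNonunimodular.lean`). Á. Timár,
*Percolation on nonunimodular transitive graphs*, Ann. Probab. 34 (2006) 2344–2364, §5, p. 2357: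

> **Lemma 5.3.** … Furthermore, let `L₀` be a class of the 1-partition of `G` and suppose that
> `L₀ ∩ ω` contains some encounter point. Then for any encounter point `x ∈ L₀ ∩ ω` and any open
> heavy component `C` in `ω ∖ {x}` that is adjacent to `x` in `ω`, `C ∩ L₀` contains some vertex
> that is an encounter point for `ω`.
>
> *Proof.* … Suppose now that there exists an encounter point `x` and that `C` is a heavy
> component of `ω ∖ {x}` that is adjacent to `x` and such that `C ∩ L₀` does not contain any
> encounter points. Then let each vertex `y` contained in such a `C ∩ L₀` send mass `1` to `x` in
> `L₀ ∩ W`, where `x` is an encounter point and where there is an `x`–`y` path in `ω` that does not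
> contain any other encounter point inside `L₀`. Since `C ∩ L₀` is infinite (by deletion tolerance
> and Lemma 5.2), the expected mass received is infinite. The expected mass sent out is at most
> `1`. This MTP contradiction proves the second part of the claimed assertion.

We PROVE this on the space `BondConfig V × UnitAddCircle` (percolation and the parameter `θ` of
the 1-partition, `TimarOnePartition.lean`) with the diagonal action of `Aut(G)`, for `G` connected,
locally finite, transitive, nonunimodular and `0 < p < 1`:

* `Sends ω θ y x` — the transport: `x` is an encounter point in the class of `y`, and `y` lies in
  a heavy branch at `x` (branch of a vertex of the cluster of `x`) containing no encounter point of
  the class of `x`; **the receiver is unique** (`Sends.unique`: two receivers `x ≠ x'` would each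
  lie outside the other's branch through `y`, so every open path from `y` to `x` passes `x'` and
  vice versa — impossible along a shortest one), so this is a unit-mass point allocation
  (`sendTo`, in the format of `measure_isSome_eq`, `TimarMassTransport.lean`);
* invariance and measurability of the allocation, invariance of `P_p ⊗ Haar` under the diagonal
  action (`map_pairAct`);
* `ae_infinite_branchSet_inter_class` — "`C ∩ L₀` is infinite (by deletion tolerance and Lemma
  5.2)" jointly in `(ω, θ)`: for fixed `θ` a class is a fixed slab
  (`setOf_onePartitionRel_eq_weightSlab`) and `ae_infinite_branchSet_inter_weightSlab`
  (`TimarEncounterPoints.lean`) applies; Fubini;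
* `ae_exists_isEncounter_of_branch` — **Lemma 5.3, second part**: almost surely, for every
  encounter point `x`, every `u ∈ C(x)` with heavy branch at `x`, the branch contains an encounter
  point `z` with `x ∼_θ z`. (MTP: the weighted mass received by a violating `x` is at least
  `Δ b · |C ∩ L₀| = ∞`, the mass sent is `≤ 1`; `measure_isSome_eq`.)

## References

* Á. Timár, Ann. Probab. 34 (2006) 2344–2364 (arXiv:math/0702875), §5, Lemma 5.3 and its proof;
  Lemma 2.2. [Timar2006]
* R. Lyons, Y. Peres, *Probability on Trees and Networks*, CUP 2016, §8.2 ((8.10)). [LyonsPeres2016]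
-/

noncomputable section

namespace Literature.Barriers.CriticalPhenomena

open _root_.MeasureTheory _root_.Filter Literature.Probability.Percolation SimpleGraph
open scoped ENNReal Topology

variable {V : Type*} {G : SimpleGraph V} [G.LocallyFinite]

/-! ### The transport and the uniqueness of the receiver -/

/-- **`y` sends unit mass to `x`**: `x` is an encounter point in the class of `y`, and `y` lies in
a heavy branch at `x` — the branch of a vertex `u` of the cluster of `x` — that contains no
encounter point of the class of `x` ("let each vertex `y` contained in such a `C ∩ L₀` send mass `1`
to `x`"). [cite: Timar2006, Lemma 5.3 (proof: the mass transport)] -/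
def Sends (G : SimpleGraph V) [G.LocallyFinite] (o : V) (ω : BondConfig V) (θ : UnitAddCircle)
    (y x : V) : Prop :=
  IsEncounter G o ω x ∧ OnePartitionRel G o θ x y ∧
    ∃ u ∈ openCluster ω x, y ∈ branchSet ω x u ∧ IsHeavy G o (branchSet ω x u) ∧
      ∀ z ∈ branchSet ω x u, OnePartitionRel G o θ x z → ¬ IsEncounter G o ω z

variable {o : V}

/-- A receiver `x'` other than `x` is not in the branch through `y` at `x`. [folklore] -/
theorem Sends.not_avoidReach {ω : BondConfig V} {θ : UnitAddCircle} {y x x' : V}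
    (h : Sends G o ω θ y x) (h' : Sends G o ω θ y x') :
    ¬ AvoidReach (openGraph ω) x y x' := by
  intro hyx'
  obtain ⟨u, -, hyu, -, hno⟩ := h.2.2
  have hE := onePartitionRel_equivalence G o θ
  -- `x'` is in the branch of `y` at `x`, in the class of `x`, and an encounter point
  exact hno x' (hyu.trans hyx') (hE.trans h.2.1 (hE.symm h'.2.1)) h'.1

/-- **The receiver is unique** ("send mass `1` to `x` … where there is an `x`–`y` path in `ω`
that does not contain any other encounter point inside `L₀`": there is at most one such `x`).
[cite: Timar2006, Lemma 5.3 (proof: expected mass sent out is at most 1)] -/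
theorem Sends.unique {ω : BondConfig V} {θ : UnitAddCircle} {y x x' : V}
    (h : Sends G o ω θ y x) (h' : Sends G o ω θ y x') : x = x' := by
  classical
  by_contra hne
  have h1 : ¬ AvoidReach (openGraph ω) x y x' := h.not_avoidReach h'
  have h2 : ¬ AvoidReach (openGraph ω) x' y x := h'.not_avoidReach h
  -- `y` is joined to `x` (it lies in a branch of a vertex of `C(x)`)
  obtain ⟨u, hu, hyu, -, -⟩ := h.2.2
  have hyx : (openGraph ω).Reachable y x :=
    (hyu.reachable.symm).trans (show (openGraph ω).Reachable u x from Reachable.symm hu)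
  obtain ⟨q⟩ := hyx
  set p := q.bypass with hp
  have hpath : p.IsPath := q.bypass_isPath
  -- a path from `y` to `x` avoiding `x'` would contradict `h2`; so it passes `x'` …
  by_cases hx' : x' ∈ p.support
  · -- … and its initial segment to `x'` avoids `x`, contradicting `h1`
    have hxne : x ≠ x' := hne
    exact h1 ⟨p.takeUntil x' hx', Walk.endpoint_notMem_support_takeUntil hpath hx' hxne⟩
  · exact h2 ⟨p, hx'⟩

/-! ### The point allocation -/

open Classical in
/-- **The point allocation of the proof of Lemma 5.3**: `y ↦` its unique receiver, if any.
[cite: Timar2006, Lemma 5.3 (proof: the mass transport)] -/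
def sendTo (G : SimpleGraph V) [G.LocallyFinite] (o : V) (q : BondConfig V × UnitAddCircle) (y : V) :
    Option V :=
  if h : ∃ x, Sends G o q.1 q.2 y x then some h.choose else none

/-- `sendTo y = some x ↔ Sends y x` (uniqueness of the receiver). [folklore] -/
theorem sendTo_eq_some_iff {q : BondConfig V × UnitAddCircle} {y x : V} :
    sendTo G o q y = some x ↔ Sends G o q.1 q.2 y x := by
  classical
  unfold sendTo
  split_ifs with h
  · rw [Option.some.injEq]
    exact ⟨fun hx => hx ▸ h.choose_spec, fun hx => h.choose_spec.unique hx⟩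
  · simp only [false_iff]
    exact fun hx => h ⟨x, hx⟩

/-! ### The action of `Aut(G)` on `(ω, θ)` -/

section Action

variable (G) (o)

/-- The diagonal action on `(ω, θ)`. [cite: Timar2006, §5 (invariance of the 1-partition)] -/
def pairAct (γ : G ≃g G) (q : BondConfig V × UnitAddCircle) : BondConfig V × UnitAddCircle :=
  (BondConfig.relabel (sym2Equiv γ.toEquiv) q.1, onePartitionAct G o γ q.2)

/-- The action is measurable … [folklore] -/
theorem measurable_pairAct (γ : G ≃g G) : Measurable (pairAct G o γ) :=
  (BondConfig.relabel (sym2Equiv γ.toEquiv)).measurable.prodMap (measurable_onePartitionAct γ)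

/-- … and preserves `P_p ⊗ Haar`. [cite: Timar2006, §5 (invariance of the 1-partition)] -/
theorem map_pairAct [Countable V] (p : unitInterval) (γ : G ≃g G) :
    ((bondPercolation G p).prod (volume : Measure UnitAddCircle)).map (pairAct G o γ) =
      (bondPercolation G p).prod (volume : Measure UnitAddCircle) :=
  (MeasurePreserving.prod ⟨(BondConfig.relabel (sym2Equiv γ.toEquiv)).measurable,
    bondPercolation_map_relabel_iso γ p⟩ (measurePreserving_onePartitionAct γ)).map_eq

variable {G o}

/-- `Sends` is transported by the action. [cite: Timar2006, Lemma 5.3 (proof: invariance of the transport)] -/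
theorem sends_pairAct_iff (hconn : G.Connected) (γ : G ≃g G) (q : BondConfig V × UnitAddCircle)
    (y x : V) : Sends G o (pairAct G o γ q).1 (pairAct G o γ q).2 (γ y) (γ x) ↔ Sends G o q.1 q.2 y x := by
  have hC : openCluster (BondConfig.relabel (sym2Equiv γ.toEquiv) q.1) (γ x) =
      (γ : V → V) '' openCluster q.1 x := openCluster_relabel γ.toEquiv q.1 x
  have hB : ∀ u, branchSet (BondConfig.relabel (sym2Equiv γ.toEquiv) q.1) (γ x) (γ u) =
      (γ : V → V) '' branchSet q.1 x u := fun u => branchSet_relabel γ.toEquiv q.1 x u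
  simp only [Sends, pairAct]
  rw [isEncounter_relabel_iff G hconn γ o, onePartitionRel_act_iff hconn, hC]
  refine and_congr_right fun _ => and_congr_right fun _ => ⟨?_, ?_⟩
  · rintro ⟨u', ⟨u, hu, rfl⟩, hy, hH, hno⟩
    rw [hB u, γ.injective.mem_set_image] at hy
    rw [hB u, isHeavy_image_iff G hconn γ o] at hH
    refine ⟨u, hu, hy, hH, fun z hz hR hE => hno (γ z) ?_ ?_ ?_⟩
    · rw [hB u]; exact ⟨z, hz, rfl⟩
    · exact (onePartitionRel_act_iff hconn γ q.2 x z).2 hR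
    · exact (isEncounter_relabel_iff G hconn γ o q.1 z).2 hE
  · rintro ⟨u, hu, hy, hH, hno⟩
    refine ⟨γ u, ⟨u, hu, rfl⟩, ?_, ?_, ?_⟩
    · rw [hB u, γ.injective.mem_set_image]; exact hy
    · rw [hB u, isHeavy_image_iff G hconn γ o]; exact hH
    · rintro _ hz' hR hE
      rw [hB u] at hz'
      obtain ⟨z, hz, rfl⟩ := hz'
      exact hno z hz ((onePartitionRel_act_iff hconn γ q.2 x z).1 hR)
        ((isEncounter_relabel_iff G hconn γ o q.1 z).1 hE)

/-- The point allocation is equivariant. [folklore] -/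
theorem sendTo_pairAct (hconn : G.Connected) (γ : G ≃g G) (q : BondConfig V × UnitAddCircle) (y : V) :
    sendTo G o (pairAct G o γ q) (γ y) = (sendTo G o q y).map γ := by
  cases h : sendTo G o q y with
  | none =>
    rw [Option.map_none]
    cases h' : sendTo G o (pairAct G o γ q) (γ y) with
    | none => rfl
    | some x' =>
      exfalso
      have hs := sendTo_eq_some_iff.1 h'
      rw [← γ.apply_symm_apply x'] at hs
      have := (sends_pairAct_iff hconn γ q y (γ.symm x')).1 hs
      rw [← sendTo_eq_some_iff] at this
      rw [h] at this
      exact Option.some_ne_none _ this.symm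
  | some x =>
    rw [Option.map_some]
    exact sendTo_eq_some_iff.2 ((sends_pairAct_iff hconn γ q y x).2 (sendTo_eq_some_iff.1 h))

end Action

/-! ### Measurability -/

section Measurable

variable [Countable V]

/-- `{y ∈ branch of u at x}` is measurable in the configuration. [folklore] -/
theorem measurableSet_mem_branchSet (x u y : V) :
    MeasurableSet {ω : BondConfig V | y ∈ branchSet ω x u} :=
  measurableSet_avoidReach x u y

/-- `{Sends y x}` is measurable in `(ω, θ)`. [folklore] -/
theorem measurableSet_sends (o y x : V) :
    MeasurableSet {q : BondConfig V × UnitAddCircle | Sends G o q.1 q.2 y x} := by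
  have h : {q : BondConfig V × UnitAddCircle | Sends G o q.1 q.2 y x} =
      (Prod.fst ⁻¹' {ω | IsEncounter G o ω x}) ∩ ((Prod.snd ⁻¹' {θ | OnePartitionRel G o θ x y}) ∩
        ⋃ u, ((Prod.fst ⁻¹' {ω | (openGraph ω).Reachable x u}) ∩ ((Prod.fst ⁻¹' {ω | y ∈ branchSet ω x u}) ∩
          ((Prod.fst ⁻¹' {ω | IsHeavy G o (branchSet ω x u)}) ∩
            ⋂ z, ((Prod.fst ⁻¹' {ω | z ∈ branchSet ω x u})ᶜ ∪ ((Prod.snd ⁻¹' {θ | OnePartitionRel G o θ x z})ᶜ ∪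
              (Prod.fst ⁻¹' {ω | IsEncounter G o ω z})ᶜ)))))) := by
    ext q
    simp only [Sends, Set.mem_setOf_eq, Set.mem_inter_iff, Set.mem_preimage, Set.mem_iUnion,
      Set.mem_iInter, Set.mem_union, Set.mem_compl_iff]
    refine and_congr_right fun _ => and_congr_right fun _ => exists_congr fun u => ?_
    refine and_congr_right fun _ => and_congr_right fun _ => and_congr_right fun _ => ?_
    refine forall_congr' fun z => ⟨fun h' => ?_, fun h' hz hR hE => ?_⟩
    · by_cases hz : z ∈ branchSet q.1 x u
      · by_cases hR : OnePartitionRel G o q.2 x z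
        · exact Or.inr (Or.inr (h' hz hR))
        · exact Or.inr (Or.inl hR)
      · exact Or.inl hz
    · rcases h' with h' | h' | h'
      · exact absurd hz h'
      · exact absurd hR h'
      · exact h' hE
  rw [h]
  refine ((measurableSet_isEncounter G o x).preimage measurable_fst).inter
    (((measurableSet_setOf_onePartitionRel x y).preimage measurable_snd).inter
      (MeasurableSet.iUnion fun u => ?_))
  refine ((measurableSet_setOf_reachable x u).preimage measurable_fst).inter
    (((measurableSet_mem_branchSet x u y).preimage measurable_fst).inter
      (((measurableSet_isHeavy_branchSet G o x u).preimage measurable_fst).inter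
        (MeasurableSet.iInter fun z => ?_)))
  exact ((measurableSet_mem_branchSet x u z).preimage measurable_fst).compl.union
    ((((measurableSet_setOf_onePartitionRel x z).preimage measurable_snd).compl).union
      ((measurableSet_isEncounter G o z).preimage measurable_fst).compl)

/-- The fibres of the allocation are measurable. [folklore] -/
theorem measurableSet_sendTo_eq_some (o y x : V) :
    MeasurableSet {q : BondConfig V × UnitAddCircle | sendTo G o q y = some x} := by
  simp_rw [sendTo_eq_some_iff]
  exact measurableSet_sends o y x

/-- The event "some heavy branch meets the class of its base vertex in finitely many vertices" is
measurable in `(ω, θ)`. [folklore] -/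
theorem measurableSet_finite_branchSet_inter_class (o x u : V) :
    MeasurableSet {q : BondConfig V × UnitAddCircle |
      (branchSet q.1 x u ∩ {z | OnePartitionRel G o q.2 x z}).Finite} := by
  have henc : Measurable fun q : BondConfig V × UnitAddCircle =>
      ((branchSet q.1 x u ∩ {z | OnePartitionRel G o q.2 x z}).encard : ENNReal) := by
    have h : ∀ q : BondConfig V × UnitAddCircle,
        ((branchSet q.1 x u ∩ {z | OnePartitionRel G o q.2 x z}).encard : ENNReal) =
          ∑' z, ({q' : BondConfig V × UnitAddCircle | z ∈ branchSet q'.1 x u} ∩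
            {q' | OnePartitionRel G o q'.2 x z}).indicator 1 q := by
      intro q
      rw [show (((branchSet q.1 x u ∩ {z | OnePartitionRel G o q.2 x z}).encard : ENNReal)) =
          ∑' z, (branchSet q.1 x u ∩ {z | OnePartitionRel G o q.2 x z}).indicator 1 z by
        rw [show (1 : V → ENNReal) = fun _ => 1 from rfl, tsum_indicator_const, mul_one]]
      refine tsum_congr fun z => ?_
      by_cases hz : z ∈ branchSet q.1 x u ∩ {z | OnePartitionRel G o q.2 x z}
      · rw [Set.indicator_of_mem hz, Set.indicator_of_mem
          (show q ∈ {q' : BondConfig V × UnitAddCircle | z ∈ branchSet q'.1 x u} ∩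
            {q' | OnePartitionRel G o q'.2 x z} from hz)]
        rfl
      · rw [Set.indicator_of_notMem hz, Set.indicator_of_notMem
          (show q ∉ {q' : BondConfig V × UnitAddCircle | z ∈ branchSet q'.1 x u} ∩
            {q' | OnePartitionRel G o q'.2 x z} from hz)]
    simp_rw [h]
    refine measurable_tsum_ennreal fun z => measurable_one.indicator ?_
    exact ((measurableSet_mem_branchSet x u z).preimage measurable_fst).inter
      ((measurableSet_setOf_onePartitionRel x z).preimage measurable_snd)
  have h : {q : BondConfig V × UnitAddCircle |
      (branchSet q.1 x u ∩ {z | OnePartitionRel G o q.2 x z}).Finite} =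
      {q | ((branchSet q.1 x u ∩ {z | OnePartitionRel G o q.2 x z}).encard : ENNReal) < ⊤} := by
    ext q
    simp only [Set.mem_setOf_eq]
    rw [ENat.toENNReal_lt_top, ← Set.encard_lt_top_iff]
  rw [h]
  exact measurableSet_lt henc measurable_const

/-- The violating event at `x` ("`C ∩ L₀` does not contain any encounter points" for a heavy
branch `C` at the encounter point `x`) is measurable. [folklore] -/
theorem measurableSet_badBranch (o x : V) :
    MeasurableSet {q : BondConfig V × UnitAddCircle | IsEncounter G o q.1 x ∧
      ∃ u ∈ openCluster q.1 x, IsHeavy G o (branchSet q.1 x u) ∧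
        ∀ z ∈ branchSet q.1 x u, OnePartitionRel G o q.2 x z → ¬ IsEncounter G o q.1 z} := by
  have h : {q : BondConfig V × UnitAddCircle | IsEncounter G o q.1 x ∧
      ∃ u ∈ openCluster q.1 x, IsHeavy G o (branchSet q.1 x u) ∧
        ∀ z ∈ branchSet q.1 x u, OnePartitionRel G o q.2 x z → ¬ IsEncounter G o q.1 z} =
      (Prod.fst ⁻¹' {ω | IsEncounter G o ω x}) ∩
        ⋃ u, ((Prod.fst ⁻¹' {ω | (openGraph ω).Reachable x u}) ∩
          ((Prod.fst ⁻¹' {ω | IsHeavy G o (branchSet ω x u)}) ∩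
            ⋂ z, ((Prod.fst ⁻¹' {ω | z ∈ branchSet ω x u})ᶜ ∪ ((Prod.snd ⁻¹' {θ | OnePartitionRel G o θ x z})ᶜ ∪
              (Prod.fst ⁻¹' {ω | IsEncounter G o ω z})ᶜ)))) := by
    ext q
    simp only [Set.mem_setOf_eq, Set.mem_inter_iff, Set.mem_preimage, Set.mem_iUnion,
      Set.mem_iInter, Set.mem_union, Set.mem_compl_iff]
    refine and_congr_right fun _ => exists_congr fun u => ?_
    refine and_congr_right fun _ => and_congr_right fun _ => ?_
    refine forall_congr' fun z => ⟨fun h' => ?_, fun h' hz hR hE => ?_⟩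
    · by_cases hz : z ∈ branchSet q.1 x u
      · by_cases hR : OnePartitionRel G o q.2 x z
        · exact Or.inr (Or.inr (h' hz hR))
        · exact Or.inr (Or.inl hR)
      · exact Or.inl hz
    · rcases h' with h' | h' | h'
      · exact absurd hz h'
      · exact absurd hR h'
      · exact h' hE
  rw [h]
  refine ((measurableSet_isEncounter G o x).preimage measurable_fst).inter (MeasurableSet.iUnion fun u => ?_)
  refine ((measurableSet_setOf_reachable x u).preimage measurable_fst).inter
    (((measurableSet_isHeavy_branchSet G o x u).preimage measurable_fst).inter
      (MeasurableSet.iInter fun z => ?_))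
  exact ((measurableSet_mem_branchSet x u z).preimage measurable_fst).compl.union
    ((((measurableSet_setOf_onePartitionRel x z).preimage measurable_snd).compl).union
      ((measurableSet_isEncounter G o z).preimage measurable_fst).compl)

end Measurable

/-! ### `C ∩ L₀` is infinite, jointly in `(ω, θ)` -/

section Probabilistic

variable [Countable V]

/-- **"`C ∩ L₀` is infinite (by deletion tolerance and Lemma 5.2)"**, jointly in `(ω, θ)`:
almost surely for `P_p ⊗ Haar`, every heavy branch at every vertex `x` meets the class of `x` in
the 1-partition in infinitely many vertices (Fubini: for fixed `θ` a class is a fixed slab of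
width `μ`, `setOf_onePartitionRel_eq_weightSlab`, and `ae_infinite_branchSet_inter_weightSlab`
applies). [cite: Timar2006, Lemma 5.3 (proof: "C ∩ L₀ is infinite")] -/
theorem ae_infinite_branchSet_inter_class (hconn : G.Connected) (ht : IsGraphTransitive G)
    (hU : ¬ IsGraphUnimodular G) {p : unitInterval} (hp0 : 0 < (p : ℝ)) (hp1 : (p : ℝ) < 1) (o : V) :
    ∀ᵐ q ∂((bondPercolation G p).prod (volume : Measure UnitAddCircle)), ∀ x u,
      IsHeavy G o (branchSet q.1 x u) →
        (branchSet q.1 x u ∩ {z | OnePartitionRel G o q.2 x z}).Infinite := by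
  set μ₂ := (bondPercolation G p).prod (volume : Measure UnitAddCircle) with hμ₂
  set N : Set (BondConfig V × UnitAddCircle) := {q | ∃ x u, IsHeavy G o (branchSet q.1 x u) ∧
      (branchSet q.1 x u ∩ {z | OnePartitionRel G o q.2 x z}).Finite} with hN
  have hNm : MeasurableSet N := by
    have h : N = ⋃ x, ⋃ u, ((Prod.fst ⁻¹' {ω | IsHeavy G o (branchSet ω x u)}) ∩
        {q | (branchSet q.1 x u ∩ {z | OnePartitionRel G o q.2 x z}).Finite}) := by
      ext q; simp only [hN, Set.mem_setOf_eq, Set.mem_iUnion, Set.mem_inter_iff, Set.mem_preimage]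
    rw [h]
    exact MeasurableSet.iUnion fun x => MeasurableSet.iUnion fun u =>
      ((measurableSet_isHeavy_branchSet G o x u).preimage measurable_fst).inter
        (measurableSet_finite_branchSet_inter_class o x u)
  have hN0 : μ₂ N = 0 := by
    rw [hμ₂, Measure.prod_apply_symm hNm]
    have hsec : ∀ θ : UnitAddCircle, bondPercolation G p ((fun ω => (ω, θ)) ⁻¹' N) = 0 := by
      intro θ
      have hcov : (fun ω => (ω, θ)) ⁻¹' N ⊆ ⋃ x, {ω : BondConfig V | ∃ u, IsHeavy G o (branchSet ω x u) ∧
          (branchSet ω x u ∩ weightSlab G o (minNbrWeight G o * oneClassTop G o θ (oneIndex G o θ x))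
            (oneClassTop G o θ (oneIndex G o θ x))).Finite} := by
        rintro ω ⟨x, u, hH, hfin⟩
        refine Set.mem_iUnion.2 ⟨x, u, hH, ?_⟩
        rw [← setOf_onePartitionRel_eq_weightSlab hconn ht hU θ x]
        exact hfin
      refine measure_mono_null hcov (measure_iUnion_null fun x => ?_)
      refine measure_mono_null ?_ (ae_iff.1 (ae_infinite_branchSet_inter_weightSlab hconn ht hU hp0 hp1 o
        (le_refl (minNbrWeight G o * oneClassTop G o θ (oneIndex G o θ x)))
        (oneClassTop_ne_zero hconn ht hU θ _) (oneClassTop_ne_top θ _)))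
      rintro ω ⟨u, hH, hfin⟩ hall
      exact hfin.not_infinite (hall x u hH)
    simp only [hsec, lintegral_zero]
  filter_upwards [measure_eq_zero_iff_ae_notMem.1 hN0] with q hq x u hH
  by_contra hfin
  exact hq ⟨x, u, hH, Set.not_infinite.1 hfin⟩

/-- **Timár 2006, Lemma 5.3, second part, PROVED.** On a connected, locally finite, transitive,
nonunimodular graph, for `0 < p < 1`, almost surely for `P_p ⊗ Haar` (percolation and
1-partition): for every encounter point `x`, every vertex `u` of the cluster of `x` whose branch
at `x` is heavy, the branch contains an encounter point of the class of `x` ("`C ∩ L₀` contains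
some vertex that is an encounter point for `ω`"). Proof as printed: the point allocation `sendTo`
sends mass `≤ 1` out of every vertex; if the event failed at `x` with positive probability, the
weighted mass received by `x` would be `≥ Δ b · |C ∩ L₀| = ∞` (`ae_infinite_branchSet_inter_class`,
the class of `x` being the slab `(Δ b, b]`), contradicting `measure_isSome_eq` (Lemma 2.2).
[cite: Timar2006, Lemma 5.3 (second part) and its proof] -/
theorem ae_exists_isEncounter_of_branch (hconn : G.Connected) (ht : IsGraphTransitive G)
    (hU : ¬ IsGraphUnimodular G) {p : unitInterval} (hp0 : 0 < (p : ℝ)) (hp1 : (p : ℝ) < 1) (o : V) :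
    ∀ᵐ q ∂((bondPercolation G p).prod (volume : Measure UnitAddCircle)), ∀ x,
      IsEncounter G o q.1 x → ∀ u ∈ openCluster q.1 x, IsHeavy G o (branchSet q.1 x u) →
        ∃ z ∈ branchSet q.1 x u, IsEncounter G o q.1 z ∧ OnePartitionRel G o q.2 x z := by
  classical
  set μ₂ := (bondPercolation G p).prod (volume : Measure UnitAddCircle) with hμ₂
  -- the violating event at `x` is null
  have hnull : ∀ x, μ₂ {q | IsEncounter G o q.1 x ∧ ∃ u ∈ openCluster q.1 x, IsHeavy G o (branchSet q.1 x u) ∧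
      ∀ z ∈ branchSet q.1 x u, OnePartitionRel G o q.2 x z → ¬ IsEncounter G o q.1 z} = 0 := by
    intro x
    set Bad := {q : BondConfig V × UnitAddCircle | IsEncounter G o q.1 x ∧
      ∃ u ∈ openCluster q.1 x, IsHeavy G o (branchSet q.1 x u) ∧
        ∀ z ∈ branchSet q.1 x u, OnePartitionRel G o q.2 x z → ¬ IsEncounter G o q.1 z} with hBad
    have hBm : MeasurableSet Bad := measurableSet_badBranch o x
    have hmtp := measure_isSome_eq hconn ht μ₂ (pairAct G o) (measurable_pairAct G o) (map_pairAct G o p)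
      (τ := sendTo G o) (fun y x => measurableSet_sendTo_eq_some o y x) (sendTo_pairAct hconn) o x
    have hx0 := autWeight_ne_zero G hconn o x
    have hxT := autWeight_ne_top G hconn o x
    -- on `Bad ∩ A` the weighted mass received is `∞`
    have hrecv : ∀ᵐ q ∂μ₂, Bad.indicator (fun _ => (⊤ : ENNReal)) q ≤
        ∑' y, ({y | sendTo G o q y = some x} : Set V).indicator (autWeight G o) y := by
      filter_upwards [ae_infinite_branchSet_inter_class hconn ht hU hp0 hp1 o] with q hA
      by_cases hq : q ∈ Bad
      · rw [Set.indicator_of_mem hq, top_le_iff]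
        obtain ⟨hxE, u, hu, hH, hno⟩ := hq
        set S := branchSet q.1 x u ∩ {z | OnePartitionRel G o q.2 x z} with hS
        have hSinf : S.Infinite := hA x u hH
        have hSsub : S ⊆ {y | sendTo G o q y = some x} := fun y hy =>
          sendTo_eq_some_iff.2 ⟨hxE, hy.2, u, hu, hy.1, hH, hno⟩
        -- weights on the class of `x` are `> Δ b`
        obtain ⟨b, hb0, hbT, hslab⟩ := exists_setOf_onePartitionRel_eq_weightSlab (o := o) hconn ht hU q.2 x
        have hlow : S ∩ {v | minNbrWeight G o * b ≤ autWeight G o v} = S := by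
          refine Set.inter_eq_left.2 fun y hy => ?_
          have : y ∈ weightSlab G o (minNbrWeight G o * b) b := by rw [← hslab]; exact hy.2
          exact this.1.le
        have hSw : setWeight G o S = ⊤ := by
          have h := mul_encard_le_setWeight G o S (minNbrWeight G o * b)
          rw [hlow, Set.encard_eq_top_iff.2 hSinf, ENat.toENNReal_top,
            ENNReal.mul_top (mul_ne_zero (minNbrWeight_ne_zero hconn o) hb0)] at h
          exact eq_top_iff.2 h
        rw [eq_top_iff, ← hSw, setWeight]
        exact ENNReal.tsum_le_tsum fun y => Set.indicator_le_indicator_of_subset hSsub (fun _ => zero_le) y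
      · rw [Set.indicator_of_notMem hq]; exact bot_le
    by_contra hne
    have hint : ⊤ * μ₂ Bad ≤ ∫⁻ q, ∑' y, ({y | sendTo G o q y = some x} : Set V).indicator (autWeight G o) y ∂μ₂ := by
      rw [← lintegral_indicator_const hBm]
      exact lintegral_mono_ae hrecv
    rw [ENNReal.top_mul hne, top_le_iff] at hint
    rw [hint, ENNReal.mul_top (ENNReal.inv_ne_zero.2 hxT)] at hmtp
    exact absurd hmtp (measure_ne_top _ _)
  have hae : ∀ᵐ q ∂μ₂, ∀ x, ¬ (IsEncounter G o q.1 x ∧ ∃ u ∈ openCluster q.1 x, IsHeavy G o (branchSet q.1 x u) ∧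
      ∀ z ∈ branchSet q.1 x u, OnePartitionRel G o q.2 x z → ¬ IsEncounter G o q.1 z) := by
    rw [ae_all_iff]; intro x
    exact measure_eq_zero_iff_ae_notMem.1 (hnull x)
  filter_upwards [hae] with q hq x hxE u hu hH
  by_contra hno
  push Not at hno
  exact hq x ⟨hxE, u, hu, hH, fun z hz hR hE => hno z hz hE hR⟩

end Probabilistic

end Literature.Barriers.CriticalPhenomena

end
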